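/-
Copyright (c) 2026 the pub-hodgecm-mathlib formalisation cell (harness21).  Prover seat hodgecm-mathlib-R90-C10-p08 (g2), SLAB R90-TF, section S1 «Ch. 10∕12 local»;
crux H413 = `stmt-HodgeConjecture-24833`; line (D-1) «B_pos» of U4Keys :182 ∕ (S-RT), card (6a-G)(G4) (R90-C10-plan (g3) R-S1-29 (α)).  KERNEL module: THEOREMS ONLY
(no definition, no named fact, no `sorry`, no instance, no notation).  2026-09-05.
-/
import Summits.HodgeConjecture.HodgeConjecture.Theorems.R90S1BposRamGaussSphereInner      -- (6a) PART 2 (R90-C10-p04 (g2)): transport `S₁ → C`; brings PART 1 (skew unit `δ`, `ν`, `exists_map_mulSkewUnit_eq_smul`), ★ tool p864287, ★ (5a)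
import Summits.HodgeConjecture.HodgeConjecture.Theorems.R90S1BposRamSkewLineCayley        -- ★ p864158 (this seat) §3: the COSET VANISHING on translated skew balls
import Summits.HodgeConjecture.HodgeConjecture.Theorems.R90S1BposRamConductorEven          -- ★ p863739 (R90-C10-p06 (g3)): `odd_of_conductorLetters_of_fixedPrincipal` (the conductor exponent `m` is odd)
import Summits.HodgeConjecture.HodgeConjecture.Theorems.R90S1BposRamShellMeasurability     -- ★ p864304 (this seat): compact balls of `R` at any place
import Literature.NumberTheory.LocalFields.RamifiedPlaceFixedValuationParity                -- ★ fixed ⇒ even order at a ramified CM place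
import HarnessLib

/-!
# R90-TF S1 «Ch10-local» ∕ U4Keys :182, BRANCH B, POSITIVE DEPTH, TAME RAMIFIED — (6a-G)(G4): THE LEVEL-ONE SPHERE FIBRE VANISHES AT EVERY SHALLOW LEVEL
# «`Φ(a) := ∫_{|s_w| = e⁻¹} Ē(a − s) dμ⁻ = 0` for a `σ`-fixed `a` with `|ϖ|^(m+1) < |a_w| ≤ |ϖ|²» (the shells `m′ ≤ n − 3` of PAPER P-ram-1 §1 (P3); both sub-branches) [Keys1984 §7 Thm (2)]

Cell `pub/hodgecm-mathlib`, crux H413 = `stmt-HodgeConjecture-24833`, route `HCCMUnconditional`; S1 card (6a-G)(G4) (R-S1-29 (α); R90-C10-p04 (g2)'s HEADS 01:32:31Z (G4), p07 (g2)'s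
letter `hΦsh` (J-6e-3)).  THEOREMS ONLY; `--supports stmt-HodgeConjecture-24833 --as helper`, count-neutral; NOT THE PAYER of :182.
WHAT.  `Ē r = χ₁(r̂)⁻¹` (0 off units), `S₁ = {s ∈ R⁻ : |s_w| = e⁻¹}`, conductor letters at `n = m + 1` (`hcond` at `|ϖ|^(m+1)`, sharp `u₁` at `|ϖ|^m`), `hfixP` (★ p863838).  For a
`σ`-FIXED `a` with `|ϖ|^(m+1) < |a_w| ≤ |ϖ|²` the fibre VANISHES (PAPER P-ram-1 1fba7ee70e95cdc9 §1 (P3) «`m′ ≤ n−3`»; p01 (g3) cross §2): `|a_w| = |ϖ|^m` is impossible (fixed ⇒ even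
order ★, `m` odd ★ p863739), so `|ϖ|^(m−1) ≤ |a_w|`; in R90-C10-p04 (g2)'s currency `Φ(a) = Ē(−δ)·∫_C Ē(c)Ē(1 + uc⁻¹) dν` (PART 2 §1, `u = −aδ⁻¹`) `= Ē(−δ)·∫_C E(c)Ē(1 + uc) dν` (★ p864287
inversion invariance, `E r = χ₁(r̂)`); substituting `c ↦ (1+f)c` for `f ∈ B := {f ∈ R⁺ : |f_w| ≤ e⁻²}` (★ p864287 §1; `E((1+f)c) = E(c)` by `hfixP`) and `ν`-averaging over `B` (Fubini
on `C × B`, integrand bounded by `1`) replaces `Ē(1 + uc)` by `∫_B Ē(1 + uc + ucf) dν(f)` = push-forward by the skew unit `t = uc` (PART 1 `exists_map_mulSkewUnit_eq_smul`) of the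
TRANSLATED skew ball `{|y − t|_w ≤ |t||ϖ|²}` — zero by ★ p864158 §3 with witness `u₁` (`|ϖ|^m ≤ |t||ϖ|²`).  Both sub-branches (no `hfix`, no `hFε`).
* §1 **`setIntegral_fixedBall_diteInv_one_add_add_mul_eq_zero`** — the inner average `∫_B Ē(1 + t + t·f) dν(f) = 0` for a skew unit `t`, `|ϖ|^m ≤ |t_w||ϖ|² `, `|t_w| ≤ 1`.
* §2 **`setIntegral_sphere_diteInv_sub_eq_zero_of_shallow`** — (G4), family-free: `σa = a`, `|ϖ|^(m+1) < |a_w| ≤ |ϖ|²` ⟹ `Φ(a) = 0` (p07 (g2)'s `hΦsh` instantiates `a := a′`).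
HONEST LABEL.  HC_CM is proved only modulo the 7 printed citations (2 remaining named inputs: hLiu418 = `stmt-HodgeConjecture-24832`, h413 = `stmt-HodgeConjecture-24833`) until rung 0
closes; count-neutral — pays NO socket (:182, (S-RT), A2′ OPEN); no printed citation discharged; wild corner (`v ∣ 2`) not addressed.

## References
* [Keys1984] D. Keys, *Principal series representations of special unitary groups over local fields*, Compositio Math. 51 (1984), §4–§5, §7 Theorem (2) p. 126.
* [WeilBNT1967] A. Weil, *Basic Number Theory* (1967), Ch. I §2–§4, Ch. II §5.
-/

set_option autoImplicit false
set_option linter.dupNamespace false  -- the mandated namespace has the single-problem summit's repeated segment (`HodgeConjecture.HodgeConjecture`)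

noncomputable section

open NumberField IsDedekindDomain MeasureTheory Measure Topology Set
open scoped NNReal ENNReal
open Literature.NumberTheory Literature.NumberTheory.Automorphic Literature.NumberTheory.Automorphic.UnitaryGroup
open Literature.NumberTheory.LocalFields.RamifiedPlaceFixedValuationParity

namespace Summit.HodgeConjecture.HodgeConjecture.R90.S1.BposRamGaussSphereShallow

open Summit.HodgeConjecture.HodgeConjecture.Cruxes.H413
open Summit.HodgeConjecture.HodgeConjecture.Cruxes.H413.K2E3BranchBSkewUnitSign
open Summit.HodgeConjecture.HodgeConjecture.Cruxes.H413.K2E3BranchBSkewLineIntegrals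
open Summit.HodgeConjecture.HodgeConjecture.R90.S1.BposRamFixedUnitsHaar
open Summit.HodgeConjecture.HodgeConjecture.R90.S1.BposRamSkewSphereByFixedUnits
open Summit.HodgeConjecture.HodgeConjecture.R90.S1.BposRamGaussSphereInner
open Summit.HodgeConjecture.HodgeConjecture.R90.S1.BposRamSkewLineCayley
open Summit.HodgeConjecture.HodgeConjecture.R90.S1.BposRamShellMeasurability
open Summit.HodgeConjecture.HodgeConjecture.R90.S1.BposSkewBallCharacterTools

-- Fubini on `C × B` over the transported Haar measure: generous budgets (class of ★ p864346)
set_option synthInstance.maxHeartbeats 400000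
set_option maxHeartbeats 1600000

variable (L : Type) [Field L] [NumberField L] [IsCMField L] (v : HeightOneSpectrum (𝓞 ↥(maximalRealSubfield L)))
  (w : PlacesOver L v) (hw : IsCMField.complexConj L • w.1 = w.1)

variable [MeasurableSpace (LocalRing L v)] [BorelSpace (LocalRing L v)]
  (μY : Measure ↥(HeisRing.skewPart (conjLocal L (IsCMField.complexConj L) v))) [μY.IsAddHaarMeasure] [μY.Regular]
  (χ₁ : (LocalRing L v)ˣ →* ℂˣ)
  (δ : (LocalRing L v)ˣ) (hδ : conjLocal L (IsCMField.complexConj L) v (δ : LocalRing L v) = -(δ : LocalRing L v))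

/-! ## §1 The inner average over the fixed ball `B = {f ∈ R⁺ : |f_w| ≤ e⁻²}` vanishes -/

open scoped Classical in
include hw in
/-- **`∫_{f ∈ R⁺, |f_w| ≤ e⁻²} Ē(1 + t + t·f) dν(f) = 0`** for `ν = μ⁻.map M⁻¹` (PART 1), a SKEW UNIT `t` of `R` with `|t_w| ≤ 1`, `χ₁` continuous with `hfixP`, `|2|_w = 1`, and a unit
`u₁` with `χ₁ u₁ ≠ 1` and `|(u₁ − 1)_{w′}| ≤ |t_w|·|ϖ|²` at every `w′`: push `ν|_B` forward by `f ↦ t·f` (★ `mulSkewUnit`; `(t·)_*ν = k • μ⁻`, PART 1 `exists_map_mulSkewUnit_eq_smul`) onto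
the skew ball `{|y_w| ≤ |t_w||ϖ|²}`, translate by `t` (`μ⁻` is translation invariant), and apply ★ p864158 §3 on the translated ball `{|y − t|_w ≤ |t_w||ϖ|²}` (for `χ₁⁻¹`, whose
letters are those of `χ₁`). [cite: Keys1984, §4–§5, §7 Theorem (2) p. 126] [cite: WeilBNT1967, Ch. II §5] -/
theorem setIntegral_fixedBall_diteInv_one_add_add_mul_eq_zero (h2w : Valued.v (2 : w.1.adicCompletion L) = 1) (h₁ : Continuous fun x => ((χ₁ x : ℂˣ) : ℂ))
    (hfixP : ∀ u : (LocalRing L v)ˣ, (∀ w' : PlacesOver L v, Valued.v (((u : LocalRing L v) w') - 1) < 1) →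
      conjLocal L (IsCMField.complexConj L) v (u : LocalRing L v) = u → χ₁ u = 1)
    {ϖ : w.1.adicCompletion L} (hϖ : Valued.v ϖ = WithZero.exp (-1 : ℤ))
    (t : (LocalRing L v)ˣ) (ht : conjLocal L (IsCMField.complexConj L) v (t : LocalRing L v) = -(t : LocalRing L v)) (ht1 : Valued.v ((t : LocalRing L v) w) ≤ 1)
    (u₁ : (LocalRing L v)ˣ) (hu₁ : ∀ w' : PlacesOver L v, Valued.v (((u₁ : LocalRing L v) w') - 1) ≤ Valued.v ((t : LocalRing L v) w) * Valued.v ϖ ^ 2) (hχu₁ : χ₁ u₁ ≠ 1) :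
    ∫ f in {f : ↥(HeisRing.fixedPart (conjLocal L (IsCMField.complexConj L) v)) | Valued.v ((f : LocalRing L v) w) ≤ WithZero.exp (-2 : ℤ)},
        (fun r : LocalRing L v => if h : IsUnit r then (((χ₁ h.unit)⁻¹ : ℂˣ) : ℂ) else 0) (1 + (t : LocalRing L v) + (t : LocalRing L v) * (f : LocalRing L v))
        ∂(μY.map (HeisRing.mulSkewUnit (conjLocal L (IsCMField.complexConj L) v) δ hδ).symm) = 0 := by
  haveI : Subsingleton (PlacesOver L v) := PlacesOver.subsingleton_of_smul_eq (IsCMField.complexConj L) (IsCMField.complexConj_ne_one L) w hw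
  set ν := μY.map (HeisRing.mulSkewUnit (conjLocal L (IsCMField.complexConj L) v) δ hδ).symm with hν
  set Mt := HeisRing.mulSkewUnit (conjLocal L (IsCMField.complexConj L) v) t ht with hMt
  set E : LocalRing L v → ℂ := fun r : LocalRing L v => if h : IsUnit r then (((χ₁ h.unit)⁻¹ : ℂˣ) : ℂ) else 0 with hEdef
  -- the radius `r = t_w·ϖ²` of `L_w`
  set r : w.1.adicCompletion L := (t : LocalRing L v) w * ϖ ^ 2 with hrdef
  have hϖ2 : Valued.v ϖ ^ 2 = WithZero.exp (-2 : ℤ) := by rw [hϖ, ← WithZero.exp_nsmul]; norm_num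
  have hrv : Valued.v r = Valued.v ((t : LocalRing L v) w) * WithZero.exp (-2 : ℤ) := by rw [hrdef, map_mul, map_pow, hϖ2]
  have ht0 : Valued.v ((t : LocalRing L v) w) ≠ 0 := by
    intro h0
    have h := units_apply_mul_inv_apply L v t w
    rw [(Valuation.zero_iff _).1 h0, zero_mul] at h; exact zero_ne_one h
  have hr0 : Valued.v r ≠ 0 := by rw [hrv]; exact mul_ne_zero ht0 WithZero.exp_ne_zero
  have hr1 : Valued.v r < 1 := by
    rw [hrv]
    calc Valued.v ((t : LocalRing L v) w) * WithZero.exp (-2 : ℤ) ≤ 1 * WithZero.exp (-2 : ℤ) := mul_le_mul_left ht1 _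
      _ < 1 := by rw [one_mul, ← WithZero.exp_zero, WithZero.exp_lt_exp]; norm_num
  -- `Mt⁻¹ {|y_w| ≤ |r|} = B`
  have hpre : Mt ⁻¹' {y : ↥(HeisRing.skewPart (conjLocal L (IsCMField.complexConj L) v)) | Valued.v ((y : LocalRing L v) w) ≤ Valued.v r} =
      {f : ↥(HeisRing.fixedPart (conjLocal L (IsCMField.complexConj L) v)) | Valued.v ((f : LocalRing L v) w) ≤ WithZero.exp (-2 : ℤ)} := by
    ext f
    rw [Set.mem_preimage, Set.mem_setOf_eq, Set.mem_setOf_eq, hMt, HeisRing.coe_mulSkewUnit, Pi.mul_apply, map_mul, hrv]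
    constructor
    · intro h
      calc Valued.v ((f : LocalRing L v) w) = (Valued.v ((t : LocalRing L v) w))⁻¹ * (Valued.v ((t : LocalRing L v) w) * Valued.v ((f : LocalRing L v) w)) := by
            rw [← mul_assoc, inv_mul_cancel₀ ht0, one_mul]
        _ ≤ (Valued.v ((t : LocalRing L v) w))⁻¹ * (Valued.v ((t : LocalRing L v) w) * WithZero.exp (-2 : ℤ)) := mul_le_mul_right h _
        _ = WithZero.exp (-2 : ℤ) := by rw [← mul_assoc, inv_mul_cancel₀ ht0, one_mul]
    · exact fun h => mul_le_mul_right h _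
  -- push forward along `Mt`
  have hpres : MeasurePreserving Mt ν (ν.map Mt) := ⟨Mt.continuous.measurable, rfl⟩
  have key := hpres.setIntegral_preimage_emb Mt.toHomeomorph.measurableEmbedding
    (fun y : ↥(HeisRing.skewPart (conjLocal L (IsCMField.complexConj L) v)) => E (1 + (t : LocalRing L v) + (y : LocalRing L v)))
    {y : ↥(HeisRing.skewPart (conjLocal L (IsCMField.complexConj L) v)) | Valued.v ((y : LocalRing L v) w) ≤ Valued.v r}
  rw [hpre] at key
  have hval : ∀ f : ↥(HeisRing.fixedPart (conjLocal L (IsCMField.complexConj L) v)),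
      (1 : LocalRing L v) + (t : LocalRing L v) + ((Mt f : ↥(HeisRing.skewPart (conjLocal L (IsCMField.complexConj L) v))) : LocalRing L v) =
        1 + (t : LocalRing L v) + (t : LocalRing L v) * (f : LocalRing L v) := by
    intro f; rw [hMt, HeisRing.coe_mulSkewUnit]
  simp_rw [hval] at key
  obtain ⟨k, hk⟩ := exists_map_mulSkewUnit_eq_smul L v μY δ hδ t ht
  rw [key, hν, hk, Measure.restrict_smul, integral_smul_nnreal_measure]
  -- translate the skew ball by `t` and apply the coset vanishing for `χ₁⁻¹`
  set tY : ↥(HeisRing.skewPart (conjLocal L (IsCMField.complexConj L) v)) := ⟨(t : LocalRing L v), (HeisRing.mem_skewPart_iff _ _).2 ht⟩ with htY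
  have hpresT : MeasurePreserving (fun y : ↥(HeisRing.skewPart (conjLocal L (IsCMField.complexConj L) v)) => y + tY) μY μY :=
    measurePreserving_add_right μY tY
  have hembT : MeasurableEmbedding (fun y : ↥(HeisRing.skewPart (conjLocal L (IsCMField.complexConj L) v)) => y + tY) :=
    (Homeomorph.addRight tY).measurableEmbedding
  have hpreT : (fun y : ↥(HeisRing.skewPart (conjLocal L (IsCMField.complexConj L) v)) => y + tY) ⁻¹'
      {y : ↥(HeisRing.skewPart (conjLocal L (IsCMField.complexConj L) v)) | Valued.v (((y : LocalRing L v) - (t : LocalRing L v)) w) ≤ Valued.v r} =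
      {y : ↥(HeisRing.skewPart (conjLocal L (IsCMField.complexConj L) v)) | Valued.v ((y : LocalRing L v) w) ≤ Valued.v r} := by
    ext y
    rw [Set.mem_preimage, Set.mem_setOf_eq, Set.mem_setOf_eq, AddSubgroup.coe_add, htY, add_sub_cancel_right]
  have keyT := hpresT.setIntegral_preimage_emb hembT
    (fun y : ↥(HeisRing.skewPart (conjLocal L (IsCMField.complexConj L) v)) => E (1 + (y : LocalRing L v)))
    {y : ↥(HeisRing.skewPart (conjLocal L (IsCMField.complexConj L) v)) | Valued.v (((y : LocalRing L v) - (t : LocalRing L v)) w) ≤ Valued.v r}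
  rw [hpreT] at keyT
  have hvalT : ∀ y : ↥(HeisRing.skewPart (conjLocal L (IsCMField.complexConj L) v)),
      (1 : LocalRing L v) + (((y + tY : ↥(HeisRing.skewPart (conjLocal L (IsCMField.complexConj L) v))) : LocalRing L v)) = 1 + (t : LocalRing L v) + (y : LocalRing L v) := by
    intro y; rw [AddSubgroup.coe_add, htY]; ring
  simp_rw [hvalT] at keyT
  rw [keyT]
  -- ★ p864158 §3 for `χ₁⁻¹`
  have h₁' : Continuous fun x => ((χ₁⁻¹ x : ℂˣ) : ℂ) := by
    have h : (fun x => ((χ₁⁻¹ x : ℂˣ) : ℂ)) = fun x => (((χ₁ x : ℂˣ) : ℂ))⁻¹ := by funext x; rw [MonoidHom.inv_apply, Units.val_inv_eq_inv_val]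
    rw [h]; exact h₁.inv₀ fun x => Units.ne_zero _
  have hfixP' : ∀ u : (LocalRing L v)ˣ, (∀ w' : PlacesOver L v, Valued.v (((u : LocalRing L v) w') - 1) < 1) →
      conjLocal L (IsCMField.complexConj L) v (u : LocalRing L v) = u → χ₁⁻¹ u = 1 := fun u hu hσu => by
    rw [MonoidHom.inv_apply, hfixP u hu hσu, inv_one]
  have hχ' : χ₁⁻¹ u₁ ≠ 1 := by rwa [MonoidHom.inv_apply, Ne, inv_eq_one]
  have hu₁r : Valued.v (((u₁ : LocalRing L v) - 1) w) ≤ Valued.v r := by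
    rw [hrv, ← hϖ2]; exact hu₁ w
  have h0 := setIntegral_skewBallTranslate_dite_one_add_eq_zero_of_level_of_fixedPrincipal L v w hw μY h2w χ₁⁻¹ h₁' hfixP' r hr0 hr1 ht ht1 u₁ hu₁r hχ'
  have hE : (fun r' : LocalRing L v => if h : IsUnit r' then ((χ₁⁻¹ h.unit : ℂˣ) : ℂ) else 0) = E := by
    funext r'; simp only [hEdef, MonoidHom.inv_apply]
  rw [hE] at h0; rw [h0, smul_zero]

/-! ## §2 (G4): the fibre vanishes at every shallow level -/

open scoped Classical in
include hw in
/-- **(G4) SHALLOW LEVELS — `∫_{|s_w| = e⁻¹} Ē(a − s) dμ⁻(s) = 0`** for a `σ`-FIXED `a ∈ R` with `|ϖ|^(m+1) < |a_w| ≤ |ϖ|²`, at a tame ramified place (`he`, `|2|_w = 1`), for a continuous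
`χ₁` with the conductor letters at `n = m + 1` (`hcond` at `|ϖ|^(m+1)`, sharp witness `u₁` at `|ϖ|^m`, `1 ≤ m`) and `hfixP` (★ p863838) — BOTH sub-branches.  Proof: the level
`|a_w| = |ϖ|^m` is impossible (`m` odd ★ `odd_of_conductorLetters_of_fixedPrincipal`, fixed ⇒ even order ★ `even_log_valued_of_complexConj_eq_self`), so `|ϖ|^(m−1) ≤ |a_w|`;
transport to `C` (PART 2 §1, skew unit `δ` of PART 1 `exists_skew_valued_eq_exp_neg_one`), inversion invariance (★ p864287: `Ē(c)Ē(1+uc⁻¹) ↤ E(c)Ē(1+uc)`), substitution `c ↦ (1+f)c`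
(★ p864287 §1; `hfixP`) for every `f ∈ B`, `ν`-average + Fubini on `C × B` (bounded by `1`), inner average `= 0` by §1 with `t = uc` (`|ϖ|^m ≤ |t_w||ϖ|²` from `|ϖ|^(m−1) ≤ |a_w|`).
= p07 (g2)'s row letter `hΦsh` (family-free form). [cite: Keys1984, §4–§5, §7 Theorem (2) p. 126] [cite: WeilBNT1967, Ch. II §5] -/
theorem setIntegral_sphere_diteInv_sub_eq_zero_of_shallow (he : v.asIdeal.ramificationIdx' w.1.asIdeal ≠ 1) (h2w : Valued.v (2 : w.1.adicCompletion L) = 1)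
    (h₁ : Continuous fun x => ((χ₁ x : ℂˣ) : ℂ))
    (hfixP : ∀ u : (LocalRing L v)ˣ, (∀ w' : PlacesOver L v, Valued.v (((u : LocalRing L v) w') - 1) < 1) →
      conjLocal L (IsCMField.complexConj L) v (u : LocalRing L v) = u → χ₁ u = 1)
    {ϖ : w.1.adicCompletion L} (hϖ : Valued.v ϖ = WithZero.exp (-1 : ℤ)) {m : ℕ} (hm : 1 ≤ m)
    (hcond : ∀ u : (LocalRing L v)ˣ, (∀ w' : PlacesOver L v, Valued.v (((u : LocalRing L v) w') - 1) ≤ Valued.v ϖ ^ (m + 1)) → χ₁ u = 1)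
    (u₁ : (LocalRing L v)ˣ) (hu₁ : ∀ w' : PlacesOver L v, Valued.v (((u₁ : LocalRing L v) w') - 1) ≤ Valued.v ϖ ^ m) (hχu₁ : χ₁ u₁ ≠ 1)
    {a : LocalRing L v} (ha : conjLocal L (IsCMField.complexConj L) v a = a)
    (hlo : Valued.v ϖ ^ (m + 1) < Valued.v (a w)) (hhi : Valued.v (a w) ≤ Valued.v ϖ ^ 2) :
    ∫ s in {s : ↥(HeisRing.skewPart (conjLocal L (IsCMField.complexConj L) v)) | Valued.v ((s : LocalRing L v) w) = WithZero.exp (-1 : ℤ)},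
        (fun r : LocalRing L v => if h : IsUnit r then (((χ₁ h.unit)⁻¹ : ℂˣ) : ℂ) else 0) (a - (s : LocalRing L v)) ∂μY = 0 := by
  haveI : Subsingleton (PlacesOver L v) := PlacesOver.subsingleton_of_smul_eq (IsCMField.complexConj L) (IsCMField.complexConj_ne_one L) w hw
  haveI : SecondCountableTopology (LocalRing L v) := secondCountableTopology_localRing (E := L) v
  have hσc := continuous_conjLocal L (IsCMField.complexConj L) v
  haveI := HeisRing.locallyCompactSpace_fixedPart (conjLocal L (IsCMField.complexConj L) v) hσc
  haveI : SecondCountableTopology ↥(HeisRing.fixedPart (conjLocal L (IsCMField.complexConj L) v)) := TopologicalSpace.Subtype.secondCountableTopology _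
  have hϖ0 : Valued.v ϖ ≠ 0 := by rw [hϖ]; exact WithZero.exp_ne_zero
  have hϖ1 : Valued.v ϖ < 1 := by rw [hϖ, ← WithZero.exp_zero, WithZero.exp_lt_exp]; norm_num
  -- PARITY: `|a_w| = exp(2k)`, `m` odd, hence `|ϖ|^(m−1) ≤ |a_w|`, i.e. `2k ≥ −(m−1)`
  have ha0 : a w ≠ 0 := fun h0 => by rw [h0, map_zero] at hlo; exact absurd hlo (not_lt.2 zero_le)
  have hσ' : galAdicCompletionMap (L := L) (IsCMField.complexConj L) hw (a w) = a w := by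
    rw [← conjLocal_apply_eq_of_smul_eq (IsCMField.complexConj L) (IsCMField.complexConj_ne_one L) v w hw a, ha]
  obtain ⟨k, hk⟩ := even_log_valued_of_complexConj_eq_self L w hw he ha0 hσ'
  have hav : Valued.v (a w) = WithZero.exp (k + k) := by rw [← hk]; exact (WithZero.exp_log ((Valuation.ne_zero_iff _).2 ha0)).symm
  obtain ⟨j, hj⟩ := BposRamConductorEven.odd_of_conductorLetters_of_fixedPrincipal L v w hw he hϖ χ₁ hfixP hm hcond u₁ hu₁ hχu₁
  have hlo' : -((m : ℤ) - 1) ≤ k + k := by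
    rw [hav, hϖ, ← WithZero.exp_nsmul, WithZero.exp_lt_exp] at hlo
    simp only [nsmul_eq_mul, mul_neg, mul_one] at hlo
    push_cast at hlo
    omega
  have hhi' : k + k ≤ -2 := by
    rw [hav, hϖ, ← WithZero.exp_nsmul, WithZero.exp_le_exp] at hhi
    simpa using hhi
  -- the skew unit `δ` with `|δ_w| = e⁻¹` and the transported measure `ν`
  obtain ⟨s₀, hs₀σ, hs₀v⟩ := exists_skew_valued_eq_exp_neg_one L v w hw he h2w
  have hs₀U : IsUnit s₀ := K2E3DepthZeroIwahoriCharacterCM.isUnit_of_apply_ne_zero L v w hw s₀ (fun h => by rw [h, map_zero] at hs₀v; exact WithZero.exp_ne_zero.symm hs₀v)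
  set δ' : (LocalRing L v)ˣ := hs₀U.unit with hδ'def
  have hδ' : conjLocal L (IsCMField.complexConj L) v (δ' : LocalRing L v) = -(δ' : LocalRing L v) := by rw [hδ'def, IsUnit.unit_spec]; exact hs₀σ
  have hδ'v : Valued.v ((δ' : LocalRing L v) w) = WithZero.exp (-1 : ℤ) := by rw [hδ'def, IsUnit.unit_spec]; exact hs₀v
  -- STEP A: transport to the fixed units (PART 2 §1), then name everything
  rw [setIntegral_sphere_diteInv_sub_eq L v w hw μY χ₁ δ' hδ' hδ'v a]
  refine mul_eq_zero_of_right _ ?_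
  set ν := μY.map (HeisRing.mulSkewUnit (conjLocal L (IsCMField.complexConj L) v) δ' hδ').symm with hν
  haveI : ν.IsAddHaarMeasure := isAddHaarMeasure_map_mulSkewUnit_symm L v μY δ' hδ'
  haveI : ν.Regular := regular_map_mulSkewUnit_symm L v μY δ' hδ'
  haveI : SigmaFinite ν := by infer_instance
  haveI : SFinite ν := by infer_instance
  -- the skew parameter `u = −aδ⁻¹`: skew, unit, `|u_w| = |a_w|·e ≤ e⁻¹`
  set u : LocalRing L v := -(a * ((δ'⁻¹ : (LocalRing L v)ˣ) : LocalRing L v)) with hudef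
  have hδinv : conjLocal L (IsCMField.complexConj L) v (((δ'⁻¹ : (LocalRing L v)ˣ)) : LocalRing L v) = -(((δ'⁻¹ : (LocalRing L v)ˣ)) : LocalRing L v) := by
    have h := congrArg (conjLocal L (IsCMField.complexConj L) v) (δ'.inv_mul)
    rw [map_mul, map_one, hδ', mul_neg] at h
    have h1 : conjLocal L (IsCMField.complexConj L) v (((δ'⁻¹ : (LocalRing L v)ˣ)) : LocalRing L v) * (δ' : LocalRing L v) = -1 := by
      linear_combination (-1 : LocalRing L v) * h
    calc conjLocal L (IsCMField.complexConj L) v (((δ'⁻¹ : (LocalRing L v)ˣ)) : LocalRing L v)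
        = conjLocal L (IsCMField.complexConj L) v (((δ'⁻¹ : (LocalRing L v)ˣ)) : LocalRing L v) * ((δ' : LocalRing L v) * ((δ'⁻¹ : (LocalRing L v)ˣ) : LocalRing L v)) := by
          rw [Units.mul_inv, mul_one]
      _ = -(((δ'⁻¹ : (LocalRing L v)ˣ)) : LocalRing L v) := by rw [← mul_assoc, h1, neg_one_mul]
  have huσ : conjLocal L (IsCMField.complexConj L) v u = -u := by
    rw [hudef, map_neg, map_mul, ha, hδinv, mul_neg]
  have hδinvv : Valued.v (((δ'⁻¹ : (LocalRing L v)ˣ) : LocalRing L v) w) = WithZero.exp (1 : ℤ) := by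
    have hv : WithZero.exp (-1 : ℤ) * Valued.v (((δ'⁻¹ : (LocalRing L v)ˣ) : LocalRing L v) w) = 1 := by
      have h := congrArg Valued.v (units_apply_mul_inv_apply L v δ' w)
      rwa [map_mul, map_one, hδ'v] at h
    have h2 := congrArg (fun z => (WithZero.exp (-1 : ℤ))⁻¹ * z) hv
    simp only [← mul_assoc, inv_mul_cancel₀ (WithZero.exp_ne_zero : WithZero.exp (-1 : ℤ) ≠ 0), one_mul, mul_one] at h2
    rw [h2, ← WithZero.exp_neg, neg_neg]
  have huv : Valued.v (u w) = WithZero.exp (k + k + 1) := by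
    rw [hudef, Pi.neg_apply, Valuation.map_neg, Pi.mul_apply, map_mul, hδinvv, hav, ← WithZero.exp_add]
  have hu0 : u w ≠ 0 := fun h0 => by
    have h := huv; rw [h0, map_zero] at h; exact WithZero.exp_ne_zero.symm h
  have huU : IsUnit u := K2E3DepthZeroIwahoriCharacterCM.isUnit_of_apply_ne_zero L v w hw u hu0
  have hu1 : Valued.v (u w) ≤ 1 := by rw [huv, ← WithZero.exp_zero, WithZero.exp_le_exp]; omega
  set C : Set ↥(HeisRing.fixedPart (conjLocal L (IsCMField.complexConj L) v)) := {c | Valued.v ((c : LocalRing L v) w) = 1} with hCdef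
  set B : Set ↥(HeisRing.fixedPart (conjLocal L (IsCMField.complexConj L) v)) := {f | Valued.v ((f : LocalRing L v) w) ≤ WithZero.exp (-2 : ℤ)} with hBdef
  set Einv : LocalRing L v → ℂ := fun r : LocalRing L v => if h : IsUnit r then (((χ₁ h.unit)⁻¹ : ℂˣ) : ℂ) else 0 with hEinv
  set Epl : LocalRing L v → ℂ := fun r : LocalRing L v => if h : IsUnit r then ((χ₁ h.unit : ℂˣ) : ℂ) else 0 with hEpl
  have hCm : MeasurableSet C := (measurableSet_fixedUnits L v w).1
  -- measurability and bounds of the two integrand factories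
  have hcontinv : Continuous fun x : (LocalRing L v)ˣ => (((χ₁ x)⁻¹ : ℂˣ) : ℂ) := by
    have h : (fun x : (LocalRing L v)ˣ => (((χ₁ x)⁻¹ : ℂˣ) : ℂ)) = fun x => (((χ₁ x : ℂˣ) : ℂ))⁻¹ := by funext x; rw [Units.val_inv_eq_inv_val]
    rw [h]; exact h₁.inv₀ fun x => Units.ne_zero _
  have hEinv_meas : Measurable Einv := measurable_dite_isUnit L v w hw (fun x => (((χ₁ x)⁻¹ : ℂˣ) : ℂ)) hcontinv
  have hEpl_meas : Measurable Epl := measurable_dite_isUnit L v w hw (fun x => ((χ₁ x : ℂˣ) : ℂ)) h₁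
  have hEinv_le : ∀ r' : LocalRing L v, Valued.v (r' w) = 1 → ‖Einv r'‖ ≤ 1 := fun r' hr' => by
    have h := norm_dite_apply_le_one L v w hw χ₁⁻¹ (by
      have h' : (fun x => ((χ₁⁻¹ x : ℂˣ) : ℂ)) = fun x => (((χ₁ x : ℂˣ) : ℂ))⁻¹ := by funext x; rw [MonoidHom.inv_apply, Units.val_inv_eq_inv_val]
      rw [h']; exact h₁.inv₀ fun x => Units.ne_zero _) r' hr'
    have hE' : Einv r' = (if h : IsUnit r' then ((χ₁⁻¹ h.unit : ℂˣ) : ℂ) else 0) := by simp only [hEinv, MonoidHom.inv_apply]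
    rw [hE']; exact h
  have hEpl_le : ∀ r' : LocalRing L v, Valued.v (r' w) = 1 → ‖Epl r'‖ ≤ 1 := fun r' hr' => norm_dite_apply_le_one L v w hw χ₁ h₁ r' hr'
  -- valuation facts: `|1 + u·c·(1 + anything small)|_w = 1`
  have hv1 : ∀ x : LocalRing L v, Valued.v (x w) < 1 → Valued.v ((1 + x) w) = 1 := fun x hx => by
    rw [Pi.add_apply, Pi.one_apply]; exact Valuation.map_one_add_of_lt _ hx
  have huc1 : ∀ c : LocalRing L v, Valued.v (c w) ≤ 1 → Valued.v ((u * c) w) < 1 := fun c hc => by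
    rw [Pi.mul_apply, map_mul, huv]
    calc WithZero.exp (k + k + 1) * Valued.v (c w) ≤ WithZero.exp (k + k + 1) * 1 := mul_le_mul_right hc _
      _ < 1 := by rw [mul_one, ← WithZero.exp_zero, WithZero.exp_lt_exp]; omega
  -- STEP B: inversion invariance `∫_C Ē(c)Ē(1 + u c⁻¹) = ∫_C E(c)Ē(1 + u c)`
  have hstepB : ∫ c in C, Einv (c : LocalRing L v) * Einv (1 + u * ((c : LocalRing L v))⁻¹) ∂ν = ∫ c in C, Epl (c : LocalRing L v) * Einv (1 + u * (c : LocalRing L v)) ∂ν := by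
    refine setIntegral_fixedUnits_eq_of_forall_eq_inv L v w hw ν (fun r' => Epl r' * Einv (1 + u * r')) (fun r' => Einv r' * Einv (1 + u * r'⁻¹))
      (hEpl_meas.mul (hEinv_meas.comp (measurable_const.add (measurable_const.mul measurable_id)))) 1 ?_ ?_
    · intro r' _ hr'v
      rw [norm_mul]
      exact (mul_le_mul (hEpl_le r' hr'v) (hEinv_le _ (hv1 _ (huc1 r' hr'v.le))) (norm_nonneg _) zero_le_one).trans_eq (mul_one _)
    · intro r' _ hr'v
      -- `Ē(r') = E(r'⁻¹)`
      have hU : IsUnit r' := isUnit_of_valued_eq_one L v w hw hr'v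
      have hinv : r'⁻¹ = (((hU.unit⁻¹ : (LocalRing L v)ˣ)) : LocalRing L v) := inv_eq_units_inv_of_valued_eq_one L v w hw hr'v
      have hUinv : IsUnit r'⁻¹ := by rw [hinv]; exact Units.isUnit _
      have hunit : hUinv.unit = hU.unit⁻¹ := Units.ext (by rw [IsUnit.unit_spec, hinv])
      have hE1 : Einv r' = Epl r'⁻¹ := by
        simp only [hEinv, hEpl, dif_pos hU, dif_pos hUinv, hunit, map_inv]
      rw [hE1]
  -- STEP C: for `f ∈ B`, the substitution `c ↦ (1+f)·c` on `C`
  have hstepC : ∀ f : ↥(HeisRing.fixedPart (conjLocal L (IsCMField.complexConj L) v)), f ∈ B →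
      ∫ c in C, Epl (c : LocalRing L v) * Einv (1 + u * (c : LocalRing L v)) ∂ν =
        ∫ c in C, Epl (c : LocalRing L v) * Einv (1 + u * (c : LocalRing L v) + u * (c : LocalRing L v) * (f : LocalRing L v)) ∂ν := by
    intro f hf
    have hfv : Valued.v ((f : LocalRing L v) w) < 1 := lt_of_le_of_lt hf (by rw [← WithZero.exp_zero, WithZero.exp_lt_exp]; norm_num)
    have hlv : Valued.v ((1 + (f : LocalRing L v)) w) = 1 := hv1 _ hfv
    have hlU : IsUnit (1 + (f : LocalRing L v)) := isUnit_of_valued_eq_one L v w hw hlv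
    have hlσ : conjLocal L (IsCMField.complexConj L) v ((hlU.unit : (LocalRing L v)ˣ) : LocalRing L v) = hlU.unit := by
      rw [IsUnit.unit_spec, map_add, map_one, (HeisRing.mem_fixedPart_iff _ _).1 f.2]
    have hlv' : Valued.v (((hlU.unit : (LocalRing L v)ˣ) : LocalRing L v) w) = 1 := by rw [IsUnit.unit_spec]; exact hlv
    have hχl : χ₁ hlU.unit = 1 := hfixP hlU.unit (fun w' => by
      obtain rfl : w' = w := Subsingleton.elim _ _
      rw [IsUnit.unit_spec, Pi.add_apply, Pi.one_apply, add_sub_cancel_left]; exact hfv) hlσ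
    have h := setIntegral_fixedUnits_comp_smulFixed_eq L v w hw ν hlU.unit hlσ hlv'
      (fun c => Epl (c : LocalRing L v) * Einv (1 + u * (c : LocalRing L v)))
    rw [← h]
    refine setIntegral_congr_fun hCm (fun c hc => ?_)
    have hcU : IsUnit (c : LocalRing L v) := isUnit_of_valued_eq_one L v w hw hc
    have hlc : ((HeisRing.smulFixed (conjLocal L (IsCMField.complexConj L) v) hlU.unit hlσ c : ↥(HeisRing.fixedPart (conjLocal L (IsCMField.complexConj L) v))) : LocalRing L v) =
        (1 + (f : LocalRing L v)) * (c : LocalRing L v) := by rw [HeisRing.coe_smulFixed, IsUnit.unit_spec]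
    have hlcU : IsUnit ((1 + (f : LocalRing L v)) * (c : LocalRing L v)) := hlU.mul hcU
    have hunit : hlcU.unit = hlU.unit * hcU.unit := Units.ext (by rw [IsUnit.unit_spec, Units.val_mul, IsUnit.unit_spec, IsUnit.unit_spec])
    rw [hlc]
    congr 1
    · simp only [hEpl, dif_pos hlcU, dif_pos hcU, hunit, map_mul, hχl, one_mul]
    · congr 1; ring
  -- STEP D: average over `B` and swap (Fubini on `C × B`, integrand bounded by `1`)
  have hBm : MeasurableSet B := ((isCompact_setOf_valued_le_exp_any L v w hw (-2)).isClosed.preimage continuous_subtype_val).measurableSet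
  have hBfin : ν B ≠ ⊤ := by
    have hBc : IsCompact B := (HeisRing.isClosed_fixedPart _ hσc).isClosedEmbedding_subtypeVal.isCompact_preimage (isCompact_setOf_valued_le_exp_any L v w hw (-2))
    exact hBc.measure_lt_top.ne
  have hBpos : ν B ≠ 0 := by
    have hBo : IsOpen B := by
      have h : B = (fun f : ↥(HeisRing.fixedPart (conjLocal L (IsCMField.complexConj L) v)) => (f : LocalRing L v) w) ⁻¹' {z | Valued.v z ≤ Valued.v (ϖ ^ 2)} := by
        ext f; simp only [hBdef, Set.mem_setOf_eq, Set.mem_preimage, map_pow, hϖ, ← WithZero.exp_nsmul]; norm_num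
      rw [h]
      exact (isOpen_setOf_valued_le_valued L v w (by rw [map_pow]; exact pow_ne_zero _ hϖ0)).preimage ((continuous_apply w).comp continuous_subtype_val)
    have hBne : B.Nonempty := ⟨⟨0, (HeisRing.mem_fixedPart_iff _ _).2 (map_zero _)⟩, by
      show Valued.v ((0 : LocalRing L v) w) ≤ WithZero.exp (-2 : ℤ); rw [Pi.zero_apply, map_zero]; exact zero_le⟩
    exact (hBo.measure_pos ν hBne).ne'
  obtain ⟨hCpos, hCtop⟩ := measure_fixedUnits_pos_lt_top L v w hw ν
  set H : ↥(HeisRing.fixedPart (conjLocal L (IsCMField.complexConj L) v)) → ↥(HeisRing.fixedPart (conjLocal L (IsCMField.complexConj L) v)) → ℂ :=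
    fun c f => Epl (c : LocalRing L v) * Einv (1 + u * (c : LocalRing L v) + u * (c : LocalRing L v) * (f : LocalRing L v)) with hHdef
  have hHmeas : Measurable (Function.uncurry H) := by
    have hc : Measurable fun p : ↥(HeisRing.fixedPart (conjLocal L (IsCMField.complexConj L) v)) × ↥(HeisRing.fixedPart (conjLocal L (IsCMField.complexConj L) v)) =>
        (p.1 : LocalRing L v) := continuous_subtype_val.measurable.comp measurable_fst
    have hf : Measurable fun p : ↥(HeisRing.fixedPart (conjLocal L (IsCMField.complexConj L) v)) × ↥(HeisRing.fixedPart (conjLocal L (IsCMField.complexConj L) v)) =>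
        (p.2 : LocalRing L v) := continuous_subtype_val.measurable.comp measurable_snd
    exact (hEpl_meas.comp hc).mul (hEinv_meas.comp ((measurable_const.add (measurable_const.mul hc)).add ((measurable_const.mul hc).mul hf)))
  have hHle : ∀ c ∈ C, ∀ f ∈ B, ‖H c f‖ ≤ 1 := by
    intro c hc f hf
    have hfv : Valued.v ((f : LocalRing L v) w) < 1 := lt_of_le_of_lt hf (by rw [← WithZero.exp_zero, WithZero.exp_lt_exp]; norm_num)
    have hx : Valued.v ((u * (c : LocalRing L v) + u * (c : LocalRing L v) * (f : LocalRing L v)) w) < 1 := by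
      have e : u * (c : LocalRing L v) + u * (c : LocalRing L v) * (f : LocalRing L v) = u * ((c : LocalRing L v) * (1 + (f : LocalRing L v))) := by ring
      rw [e]
      refine huc1 _ ?_
      rw [Pi.mul_apply, map_mul, hc, one_mul]; exact (hv1 _ hfv).le
    have h1 : Valued.v ((1 + u * (c : LocalRing L v) + u * (c : LocalRing L v) * (f : LocalRing L v)) w) = 1 := by
      rw [add_assoc]; exact hv1 _ hx
    rw [hHdef, norm_mul]
    exact (mul_le_mul (hEpl_le _ hc) (hEinv_le _ h1) (norm_nonneg _) zero_le_one).trans_eq (mul_one _)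
  have hInt : Integrable (Function.uncurry H) ((ν.restrict C).prod (ν.restrict B)) := by
    haveI : IsFiniteMeasure (ν.restrict C) := isFiniteMeasure_restrict.2 hCtop.ne
    haveI : IsFiniteMeasure (ν.restrict B) := isFiniteMeasure_restrict.2 hBfin
    refine Integrable.mono' (integrable_const (1 : ℝ)) hHmeas.aestronglyMeasurable ?_
    rw [Measure.prod_restrict]
    refine (ae_restrict_iff' (hCm.prod hBm)).2 (Filter.Eventually.of_forall fun p hp => ?_)
    exact hHle p.1 hp.1 p.2 hp.2
  have hJ : ∫ c in C, Epl (c : LocalRing L v) * Einv (1 + u * (c : LocalRing L v)) ∂ν = 0 := by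
    set J := ∫ c in C, Epl (c : LocalRing L v) * Einv (1 + u * (c : LocalRing L v)) ∂ν with hJdef
    -- `J · ν(B) = ∫_B ∫_C H = ∫_C ∫_B H = ∫_C E(c)·0 = 0`
    have h1 : ∫ f in B, (∫ c in C, H c f ∂ν) ∂ν = (ν.real B : ℂ) * J := by
      rw [setIntegral_congr_fun hBm (fun f hf => show (∫ c in C, H c f ∂ν) = J by simp only [hHdef, hJdef]; exact (hstepC f hf).symm),
        setIntegral_const, Complex.real_smul]
    have h2 : ∫ f in B, (∫ c in C, H c f ∂ν) ∂ν = ∫ c in C, (∫ f in B, H c f ∂ν) ∂ν := integral_integral_swap hInt.swap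
    have h3 : ∀ c ∈ C, ∫ f in B, H c f ∂ν = 0 := by
      intro c hc
      have hcU : IsUnit (c : LocalRing L v) := isUnit_of_valued_eq_one L v w hw hc
      -- `t := u·c` is a skew unit with `|t_w| = |u_w|`
      have htU : IsUnit (u * (c : LocalRing L v)) := huU.mul hcU
      have htσ : conjLocal L (IsCMField.complexConj L) v ((htU.unit : (LocalRing L v)ˣ) : LocalRing L v) = -((htU.unit : (LocalRing L v)ˣ) : LocalRing L v) := by
        rw [IsUnit.unit_spec, map_mul, huσ, (HeisRing.mem_fixedPart_iff _ _).1 c.2, neg_mul]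
      have htv : Valued.v (((htU.unit : (LocalRing L v)ˣ) : LocalRing L v) w) = Valued.v (u w) := by
        rw [IsUnit.unit_spec, Pi.mul_apply, map_mul, hc, mul_one]
      have ht1 : Valued.v (((htU.unit : (LocalRing L v)ˣ) : LocalRing L v) w) ≤ 1 := by rw [htv]; exact hu1
      have hu₁t : ∀ w' : PlacesOver L v, Valued.v (((u₁ : LocalRing L v) w') - 1) ≤ Valued.v (((htU.unit : (LocalRing L v)ˣ) : LocalRing L v) w) * Valued.v ϖ ^ 2 := by
        intro w'
        rw [Subsingleton.elim w' w]
        refine (hu₁ w).trans ?_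
        rw [htv, huv, hϖ, ← WithZero.exp_nsmul, ← WithZero.exp_nsmul, ← WithZero.exp_add, WithZero.exp_le_exp]
        simp only [nsmul_eq_mul]; push_cast; omega
      have h0 := setIntegral_fixedBall_diteInv_one_add_add_mul_eq_zero L v w hw μY χ₁ δ' hδ' h2w h₁ hfixP hϖ htU.unit htσ ht1 u₁ hu₁t hχu₁
      rw [IsUnit.unit_spec, ← hν] at h0
      have hH' : (fun f : ↥(HeisRing.fixedPart (conjLocal L (IsCMField.complexConj L) v)) => H c f) =
          fun f : ↥(HeisRing.fixedPart (conjLocal L (IsCMField.complexConj L) v)) =>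
            Epl (c : LocalRing L v) * Einv (1 + u * (c : LocalRing L v) + u * (c : LocalRing L v) * (f : LocalRing L v)) := rfl
      rw [hH', integral_const_mul]
      simp only [hEinv] at h0 ⊢
      rw [h0, mul_zero]
    have h4 : ∫ c in C, (∫ f in B, H c f ∂ν) ∂ν = 0 := by
      rw [setIntegral_congr_fun hCm h3, integral_zero]
    have h5 : (ν.real B : ℂ) * J = 0 := by rw [← h1, h2, h4]
    have hBr : (ν.real B : ℂ) ≠ 0 := by
      rw [Ne, Complex.ofReal_eq_zero, measureReal_def, ENNReal.toReal_eq_zero_iff, not_or]; exact ⟨hBpos, hBfin⟩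
    exact (mul_eq_zero.1 h5).resolve_left hBr
  rw [hstepB]
  exact hJ

end Summit.HodgeConjecture.HodgeConjecture.R90.S1.BposRamGaussSphereShallow

end
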